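import Summits.QuantumFields.YangMills.Theses.DualityDefect

/-!
# Birth skeleton (BC3) for crux `PeakSetsTheGap` (stmt-QuantumFields-11696) — `Lines/birth.lean`

Registrar: `planner-skel-stmt-QuantumFields-11696-0` (skeleton-register one-shot; route
`route-QuantumFields-DualityDefect`, sub-problem `YangMills`, re-audit bin REPAIRABLE), 2026-08-17.

Crux (route file `Theses/DualityDefect.lean`, decl
`Summit.QuantumFields.YangMills.Theses.DualityDefect.PeakSetsTheGap`, rank 5, "ONE NON-PERTURBATIVE
SCALE"): with the bare clover densities `S` (scalar, `flowedCloverEnergy r.ρ 0`) and `P`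
(pseudoscalar), the axis covariances `A(n) = Cov_μ(S₀, S_{n e₀})`, `B(n) = −Cov_μ(P₀, P_{n e₀})` and
the channel ratio `R = B/A` (always in product form): there are `β₀`, `c₁ > 0`, `t₀ > 0` such that
for `β ≥ β₀`, every infinite-volume limit state `μ` and every `t ≥ t₀` from which `R` is
non-increasing for good, `A(n) ≤ K e^{−c₁ n / t}` for all `n` — the scalar channel is gapped at rate
`≥ c₁/t`, i.e. `m_S(β, μ) · t_last(β, μ) ≥ c₁`.

## The cut: EXISTENCE of the scalar gap / LOCATION of the last turn in units of it

The crux is the conjunction of two statements of different nature, and the skeleton separates them: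

* `stub_scalarClustering` (G — THE GAP LEG; open problem, XL). For `β ≥ β₀` and every limit state
  `μ` the scalar clover channel clusters exponentially along the axis at SOME rate `m(β, μ) > 0`:
  `∃ m > 0, ∃ K, ∀ n, A μ n ≤ K e^{−m n}`. Qualitative, per state, no uniformity, no relation to any
  other scale: the weak-coupling infinite-volume lattice mass gap of ONE reflection-positive channel.
  (`β₀` is load-bearing: torus-limit MIXTURES at a bulk first-order point have `A(n) → a_∞ > 0`.)
* `stub_turnBeyondCorrelationLength` (U — THE ONE-SCALE LEG; open, L/XL). For `β ≥ β₀`, every `μ`,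
  every `t ≥ t₀` from which `R` is non-increasing for good, and every NEAR-OPTIMAL rate `m` of the
  scalar channel of `μ` (`m` is a clustering rate of `A μ`, `2m` is not — so `1/m ∈ [ξ_S, 2ξ_S]`,
  `ξ_S(β, μ)` the scalar correlation length of the state): `c₁ ≤ m · t`. In words: THE CHANNEL RATIO
  STILL RISES SOMEWHERE AT OR BEYOND EVERY DISTANCE SHORTER THAN `c₁ ξ_S` — the last turn of the
  duality defect happens no earlier than a fixed fraction of the scalar correlation length. This is
  a statement at FIXED PHYSICAL DISTANCE (`n ≈ c₁ ξ_S`, where the running coupling is a fixed small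
  number uniformly in `β`), the lattice shadow of the continuum AF ordering
  `ρ_P/ρ_S = 1 + 2C_A α_s(1/x)/π ↑` (KKP82 = doi:10.1016/0550-3213(82)90338-8;
  arXiv:hep-ph/9504378); it never bounds `ξ_S` in lattice units and it is vacuous where the scalar channel has no exponential rate or decays
  super-exponentially. It is a CONSEQUENCE of the crux (crux ⇒ U with `c₁/2`, by downward closure of
  rates), so it is never falser than the crux; it does not give the crux back without G.
* `PeakSetsTheGap_of : PeakSetsTheGap` (registered form, stubs BY NAME) and
  `PeakSetsTheGap_of_statements : G-statement → U-statement → PeakSetsTheGap` (hypothesis form,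
  `sorry`-free) — ONE real proof (pure real analysis, `peak_of_rates`): from G take a rate
  `m₀ > 0` of `A μ`; walk up the doubling ladder `2^k m₀`; either every `2^k m₀` is a rate
  (super-exponential decay: pick `2^k m₀ ≥ c₁/t` directly) or at the first failure `m = 2^j m₀`
  is near-optimal and U gives `c₁ ≤ m t`; in both cases
  `A μ n ≤ K e^{−m n} ≤ max(K,0) e^{−c₁ n/t}` (`rate_rescale`). `β₀ := max`, `c₁`, `t₀` from U.

Neither stub is the crux or the summit in disguise: G has no `t`, no `R`, no uniform constant; U
assumes the clustering it measures against and concludes an inequality between two scales, not a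
decay bound; neither mentions OS data, schemes or `YangMills`. BC3 probes (registrar folder `bc/`):
`stub → PeakSetsTheGap` and `stub → YangMills` by the combined
`first | exact? | simpa using h | simpa [PeakSetsTheGap] using h | aesop` FAIL 4/4, and per tactic
(`exact?`, `aesop`, `aesop (enableSimp := false)`, `simpa using h`) FAIL 16/16; the converses
`PeakSetsTheGap → stub` by `exact?` / `aesop` FAIL 4/4 too (raw outputs in `Lines/birth.md`).

## Disproof used

None exists: `Cruxes/PeakSetsTheGap/` had no workfiles before this one (no `Disproof.lean`, no
`Theorems/PeakSetsTheGap/Negative/`, no registered lines, no crux ideas); the summit's negatives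
index (5 refuted statements: RobustYangMillsRG, DiagonalMirrorRP, AdaptiveCoarseSystem,
MultibosonLatticeGap, AdmissibleRootsExist) has nothing on clover-channel clustering or channel
ratios. Refuter evidence honoured: ATTACK.md (crux-attack, SURVIVES; hidden loads (1) phase
uniqueness at all `β ≥ β₀` — kept inside G's `β₀`; (2) `t_last ≳ ξ_S` uniformly — this IS stub U;
(3) `c₁ = inf over states` — U's `c₁` is state-uniform, G's rate is not and need not be);
REVIEW.md §3 (one-sidedness `m_S t⋆ ≤ c₂` is the remainder's concern, not this crux's).

`lean check`: rc 0; sorries = 2 = stubs (`stub_scalarClustering`, `stub_turnBeyondCorrelationLength`),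
zero elsewhere. Namespace `Summit.QuantumFields.YangMills.Cruxes.PeakSetsTheGap.Birth`.
-/

set_option autoImplicit false

noncomputable section

namespace Summit.QuantumFields.YangMills.Cruxes.PeakSetsTheGap.Birth

open MeasureTheory
open Literature.MathematicalPhysics.QuantumLattice Literature.MathematicalPhysics.QuantumFieldTheory
open Summit.QuantumFields.YangMills.Theses.DualityDefect

/-- **Stub G — the scalar clover channel is gapped in every weak-coupling limit state (OPEN; the
gap leg).** For every compact simple `G` and faithful unitary `r` there is `β₀` such that for all
`β ≥ β₀` and every infinite-volume limit state `μ ∈ infiniteVolumeLimitPoints r.ρ β` the axis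
covariance of the bare scalar clover density, `A(n) = ∫ S₀ S_{n e₀} dμ − ∫ S₀ dμ ∫ S_{n e₀} dμ`,
decays exponentially at SOME rate: `∃ m > 0, ∃ K, ∀ n, A(n) ≤ K e^{−m n}` (rate and constant may
depend on `β` and on the state). Why it might fail / why it is hard: it is the infinite-volume
lattice mass gap of the `0⁺⁺` channel at ALL large `β` (printed only at strong coupling,
Osterwalder–Seiler 1978 = tree `osterwalderSeiler_clustering`); `β₀` is load-bearing (mixture
states at a bulk transition of some `(G, r)` have `A(n) → a_∞ > 0`). Sources: JaffeWitten2000,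
ChatterjeeYMProb2019 (arXiv:1803.01950), OsterwalderSeiler1978 §4,
Literature.Barriers.QuantumFields.PerturbativeInvisibility. -/
theorem stub_scalarClustering :
    ∀ (G : Type) [Group G] [TopologicalSpace G] [IsTopologicalGroup G] [CompactSpace G] [MeasurableSpace G] [BorelSpace G], IsCompactSimpleLieGroup G → ∀ r : LatticeRep G, let S : (Fin 4 → ℤ) → LGConfig 4 G → ℝ := fun x U => flowedCloverEnergy r.ρ 0 x U; let e : ℕ → (Fin 4 → ℤ) := fun n => (n : ℤ) • Pi.single (0 : Fin 4) (1 : ℤ); let A : Measure (LGConfig 4 G) → ℕ → ℝ := fun μ n => integral μ (fun U => S 0 U * S (e n) U) - integral μ (fun U => S 0 U) * integral μ (fun U => S (e n) U); ∃ β₀ : ℝ, ∀ β : ℝ, β₀ ≤ β → ∀ μ ∈ infiniteVolumeLimitPoints (d := 4) r.ρ β, ∃ m : ℝ, 0 < m ∧ ∃ K : ℝ, ∀ n : ℕ, A μ n ≤ K * Real.exp (-(m * n)) := by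
  sorry

/-- **Stub U — the duality defect does not turn for good inside `c₁` scalar correlation lengths
(OPEN; the one-scale leg).** There are `β₀`, `c₁ > 0`, `t₀ > 0` such that for `β ≥ β₀`, every limit
state `μ`, every `t ≥ t₀` from which the channel ratio is non-increasing for good
(`B(n+1) A(n) ≤ B(n) A(n+1)` for all `n ≥ t`) and every NEAR-OPTIMAL clustering rate `m > 0` of the
scalar channel of `μ` (`A μ n ≤ K e^{−m n}` for some `K`, while `2m` is NOT a rate:
`∀ K ∃ n, K e^{−2 m n} < A μ n`), one has `c₁ ≤ m · t` — i.e. `t_last(β, μ) ≥ c₁ ξ_S(β, μ)` up to a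
factor 2: at every distance shorter than a fixed fraction of the scalar correlation length the ratio
`R = B/A` still has a strict rise ahead of it (fixed PHYSICAL distance, running coupling small and
`β`-independent there: the lattice shadow of the continuum AF ordering of the `0⁻⁺`/`0⁺⁺` gluonic
spectral weights). A consequence of the crux (with `c₁/2`); vacuous for states without an exponential
rate or with super-exponential decay. Why it might fail: an intermediate regime — the ratio turned
for good already at `n ≪ ξ_S` (e.g. a `β`-independent last turn inherited from lattice artefacts of
the bare clovers, or `B ≡ 0` beyond some distance in some state) — is excluded by no known
principle. Sources: doi:10.1016/0550-3213(82)90338-8, arXiv:hep-ph/9504378, arXiv:hep-ph/9410372,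
arXiv:hep-lat/0503015, Literature.Barriers.QuantumFields.PerturbativeInvisibility. -/
theorem stub_turnBeyondCorrelationLength :
    ∀ (G : Type) [Group G] [TopologicalSpace G] [IsTopologicalGroup G] [CompactSpace G] [MeasurableSpace G] [BorelSpace G], IsCompactSimpleLieGroup G → ∀ r : LatticeRep G, let S : (Fin 4 → ℤ) → LGConfig 4 G → ℝ := fun x U => flowedCloverEnergy r.ρ 0 x U; let P : (Fin 4 → ℤ) → LGConfig 4 G → ℝ := fun x U => -2 * (flowedClover r.ρ 0 U x 0 1 * flowedClover r.ρ 0 U x 2 3 - flowedClover r.ρ 0 U x 0 2 * flowedClover r.ρ 0 U x 1 3 + flowedClover r.ρ 0 U x 0 3 * flowedClover r.ρ 0 U x 1 2).trace.re; let e : ℕ → (Fin 4 → ℤ) := fun n => (n : ℤ) • Pi.single (0 : Fin 4) (1 : ℤ); let A : Measure (LGConfig 4 G) → ℕ → ℝ := fun μ n => integral μ (fun U => S 0 U * S (e n) U) - integral μ (fun U => S 0 U) * integral μ (fun U => S (e n) U); let B : Measure (LGConfig 4 G) → ℕ → ℝ := fun μ n => integral μ (fun U => P 0 U) * integral μ (fun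 U => P (e n) U) - integral μ (fun U => P 0 U * P (e n) U); ∃ (β₀ c₁ : ℝ) (t₀ : ℕ), 0 < c₁ ∧ 0 < t₀ ∧ ∀ β : ℝ, β₀ ≤ β → ∀ μ ∈ infiniteVolumeLimitPoints (d := 4) r.ρ β, ∀ t : ℕ, t₀ ≤ t → (∀ n : ℕ, t ≤ n → B μ (n + 1) * A μ n ≤ B μ n * A μ (n + 1)) → ∀ m : ℝ, 0 < m → (∃ K : ℝ, ∀ n : ℕ, A μ n ≤ K * Real.exp (-(m * n))) → (∀ K : ℝ, ∃ n : ℕ, K * Real.exp (-(2 * m * n)) < A μ n) → c₁ ≤ m * t := by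
  sorry

/-! ### Pure real analysis used by the composition (sorry-free) -/

/-- Rescaling a clustering bound: a rate `m ≥ c/t` gives the rate `c/t` with constant `max K 0`. -/
theorem rate_rescale {a : ℕ → ℝ} {m c : ℝ} {t : ℕ} (ht : 0 < t) (hcm : c ≤ m * t)
    (h : ∃ K : ℝ, ∀ n : ℕ, a n ≤ K * Real.exp (-(m * n))) :
    ∃ K : ℝ, ∀ n : ℕ, a n ≤ K * Real.exp (-(c * n / t)) := by
  obtain ⟨K, hK⟩ := h
  have htR : (0 : ℝ) < t := by exact_mod_cast ht
  refine ⟨max K 0, fun n => ?_⟩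
  have hn : (0 : ℝ) ≤ n := n.cast_nonneg
  have hle : c * n / t ≤ m * n := by
    rw [div_le_iff₀ htR]
    calc c * (n : ℝ) ≤ m * t * n := mul_le_mul_of_nonneg_right hcm hn
      _ = m * n * t := by ring
  have hexp : Real.exp (-(m * n)) ≤ Real.exp (-(c * n / t)) := Real.exp_le_exp.mpr (by linarith)
  calc a n ≤ K * Real.exp (-(m * n)) := hK n
    _ ≤ max K 0 * Real.exp (-(m * n)) :=
        mul_le_mul_of_nonneg_right (le_max_left _ _) (Real.exp_nonneg _)
    _ ≤ max K 0 * Real.exp (-(c * n / t)) := mul_le_mul_of_nonneg_left hexp (le_max_right _ _)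

/-- **The abstract composition** (shapes of G and U ⟹ shape of the crux), for any family of
admissible states `adm β` and any pair of sequences `A, B`: walk up the doubling ladder `2^k m₀`
from a rate `m₀` supplied by G; either all doublings are rates (then pick `2^k m₀ ≥ c₁/t`), or at
the first failure the rate is near-optimal and U bounds `t` from below; finish with `rate_rescale`. -/
theorem peak_of_rates {M : Type*} (adm : ℝ → Set M) (A B : M → ℕ → ℝ)
    (hG : ∃ β₀ : ℝ, ∀ β : ℝ, β₀ ≤ β → ∀ μ ∈ adm β,
      ∃ m : ℝ, 0 < m ∧ ∃ K : ℝ, ∀ n : ℕ, A μ n ≤ K * Real.exp (-(m * n)))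
    (hU : ∃ (β₀ c₁ : ℝ) (t₀ : ℕ), 0 < c₁ ∧ 0 < t₀ ∧ ∀ β : ℝ, β₀ ≤ β → ∀ μ ∈ adm β, ∀ t : ℕ, t₀ ≤ t →
      (∀ n : ℕ, t ≤ n → B μ (n + 1) * A μ n ≤ B μ n * A μ (n + 1)) →
      ∀ m : ℝ, 0 < m → (∃ K : ℝ, ∀ n : ℕ, A μ n ≤ K * Real.exp (-(m * n))) →
      (∀ K : ℝ, ∃ n : ℕ, K * Real.exp (-(2 * m * n)) < A μ n) → c₁ ≤ m * t) :
    ∃ (β₀ c₁ : ℝ) (t₀ : ℕ), 0 < c₁ ∧ 0 < t₀ ∧ ∀ β : ℝ, β₀ ≤ β → ∀ μ ∈ adm β, ∀ t : ℕ, t₀ ≤ t →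
      (∀ n : ℕ, t ≤ n → B μ (n + 1) * A μ n ≤ B μ n * A μ (n + 1)) →
      ∃ K : ℝ, ∀ n : ℕ, A μ n ≤ K * Real.exp (-(c₁ * n / t)) := by
  obtain ⟨β₁, hG⟩ := hG
  obtain ⟨β₂, c₁, t₀, hc₁, ht₀, hU⟩ := hU
  refine ⟨max β₁ β₂, c₁, t₀, hc₁, ht₀, ?_⟩
  intro β hβ μ hμ t ht hturn
  have hβ₁ : β₁ ≤ β := le_trans (le_max_left _ _) hβ
  have hβ₂ : β₂ ≤ β := le_trans (le_max_right _ _) hβ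
  have htpos : 0 < t := lt_of_lt_of_le ht₀ ht
  have htR : (0 : ℝ) < t := by exact_mod_cast htpos
  obtain ⟨m₀, hm₀, hrate₀⟩ := hG β hβ₁ μ hμ
  -- the doubling ladder: either `2^k m₀` is still a rate, or the crux bound is already reached
  have key : ∀ k : ℕ, (∃ K : ℝ, ∀ n : ℕ, A μ n ≤ K * Real.exp (-(2 ^ k * m₀ * n))) ∨
      ∃ K : ℝ, ∀ n : ℕ, A μ n ≤ K * Real.exp (-(c₁ * n / t)) := by
    intro k
    induction k with
    | zero =>
      left
      obtain ⟨K, hK⟩ := hrate₀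
      exact ⟨K, fun n => by simpa using hK n⟩
    | succ j ih =>
      rcases ih with hRj | hdone
      · by_cases hRj1 : ∃ K : ℝ, ∀ n : ℕ, A μ n ≤ K * Real.exp (-(2 ^ (j + 1) * m₀ * n))
        · exact Or.inl hRj1
        · right
          have hnot : ∀ K : ℝ, ∃ n : ℕ, K * Real.exp (-(2 * (2 ^ j * m₀) * n)) < A μ n := by
            intro K
            by_contra hcon
            push Not at hcon
            refine hRj1 ⟨K, fun n => ?_⟩
            have e2 : (2 : ℝ) ^ (j + 1) * m₀ * n = 2 * (2 ^ j * m₀) * n := by ring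
            rw [e2]
            exact hcon n
          have hmj : (0 : ℝ) < 2 ^ j * m₀ := by positivity
          have hc : c₁ ≤ 2 ^ j * m₀ * t := hU β hβ₂ μ hμ t ht hturn (2 ^ j * m₀) hmj hRj hnot
          exact rate_rescale htpos hc hRj
      · exact Or.inr hdone
  obtain ⟨k, hk⟩ : ∃ k : ℕ, c₁ ≤ 2 ^ k * m₀ * t := by
    obtain ⟨k, hk⟩ := pow_unbounded_of_one_lt (c₁ / (m₀ * t)) (by norm_num : (1 : ℝ) < 2)
    refine ⟨k, ?_⟩
    have hmt : (0 : ℝ) < m₀ * t := mul_pos hm₀ htR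
    have h1 : c₁ < 2 ^ k * (m₀ * t) := (div_lt_iff₀ hmt).mp hk
    calc c₁ ≤ 2 ^ k * (m₀ * t) := h1.le
      _ = 2 ^ k * m₀ * t := by ring
  rcases key k with hRk | hdone
  · exact rate_rescale htpos hk hRk
  · exact hdone

/-! ### The registered composition -/

/-- **Composition (registered form)** — the crux BY NAME from the two stubs BY NAME, a real proof:
instantiate `peak_of_rates` at `adm := infiniteVolumeLimitPoints r.ρ` and the let-bound `A, B` of
the crux, feeding it `stub_scalarClustering G hG r` and `stub_turnBeyondCorrelationLength G hG r`.
(`#print axioms` = propext, Classical.choice, Quot.sound + `sorryAx` from the two stubs only; the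
hypothesis form `PeakSetsTheGap_of_statements` below is the same glue with the stub STATEMENTS as
explicit hypotheses and is `sorry`-free.) -/
theorem PeakSetsTheGap_of : PeakSetsTheGap := by
  intro G _ _ _ _ _ _ hG r S P e A B
  exact peak_of_rates (infiniteVolumeLimitPoints (d := 4) r.ρ) A B
    (stub_scalarClustering G hG r) (stub_turnBeyondCorrelationLength G hG r)

/-- **Composition (hypothesis form, BC3)** `G-statement → U-statement → PeakSetsTheGap`: no reference
to the stubs, no `sorry` anywhere in its cone (`#print axioms` = propext, Classical.choice,
Quot.sound). -/
theorem PeakSetsTheGap_of_statements :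
    (∀ (G : Type) [Group G] [TopologicalSpace G] [IsTopologicalGroup G] [CompactSpace G] [MeasurableSpace G] [BorelSpace G], IsCompactSimpleLieGroup G → ∀ r : LatticeRep G, let S : (Fin 4 → ℤ) → LGConfig 4 G → ℝ := fun x U => flowedCloverEnergy r.ρ 0 x U; let e : ℕ → (Fin 4 → ℤ) := fun n => (n : ℤ) • Pi.single (0 : Fin 4) (1 : ℤ); let A : Measure (LGConfig 4 G) → ℕ → ℝ := fun μ n => integral μ (fun U => S 0 U * S (e n) U) - integral μ (fun U => S 0 U) * integral μ (fun U => S (e n) U); ∃ β₀ : ℝ, ∀ β : ℝ, β₀ ≤ β → ∀ μ ∈ infiniteVolumeLimitPoints (d := 4) r.ρ β, ∃ m : ℝ, 0 < m ∧ ∃ K : ℝ, ∀ n : ℕ, A μ n ≤ K * Real.exp (-(m * n))) →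
    (∀ (G : Type) [Group G] [TopologicalSpace G] [IsTopologicalGroup G] [CompactSpace G] [MeasurableSpace G] [BorelSpace G], IsCompactSimpleLieGroup G → ∀ r : LatticeRep G, let S : (Fin 4 → ℤ) → LGConfig 4 G → ℝ := fun x U => flowedCloverEnergy r.ρ 0 x U; let P : (Fin 4 → ℤ) → LGConfig 4 G → ℝ := fun x U => -2 * (flowedClover r.ρ 0 U x 0 1 * flowedClover r.ρ 0 U x 2 3 - flowedClover r.ρ 0 U x 0 2 * flowedClover r.ρ 0 U x 1 3 + flowedClover r.ρ 0 U x 0 3 * flowedClover r.ρ 0 U x 1 2).trace.re; let e : ℕ → (Fin 4 → ℤ) := fun n => (n : ℤ) • Pi.single (0 : Fin 4) (1 : ℤ); let A : Measure (LGConfig 4 G) → ℕ → ℝ := fun μ n => integral μ (fun U => S 0 U * S (e n) U) - integral μ (fun U => S 0 U) * integral μ (fun U => S (e n) U); let B : Measure (LGConfig 4 G) → ℕ → ℝ := fun μ n => integral μ (fun U => P 0 U) * integral μ (fun U => P (e n) U) - integral μ (fun U => P 0 U * P (e n) U); ∃ (β₀ c₁ : ℝ) (t₀ : ℕ), 0 <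 c₁ ∧ 0 < t₀ ∧ ∀ β : ℝ, β₀ ≤ β → ∀ μ ∈ infiniteVolumeLimitPoints (d := 4) r.ρ β, ∀ t : ℕ, t₀ ≤ t → (∀ n : ℕ, t ≤ n → B μ (n + 1) * A μ n ≤ B μ n * A μ (n + 1)) → ∀ m : ℝ, 0 < m → (∃ K : ℝ, ∀ n : ℕ, A μ n ≤ K * Real.exp (-(m * n))) → (∀ K : ℝ, ∃ n : ℕ, K * Real.exp (-(2 * m * n)) < A μ n) → c₁ ≤ m * t) →
    PeakSetsTheGap := by
  intro hS hT G _ _ _ _ _ _ hG r S P e A B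
  exact peak_of_rates (infiniteVolumeLimitPoints (d := 4) r.ρ) A B (hS G hG r) (hT G hG r)

/-- Signature match: the registered composition has literally the route's crux as its type. -/
example : Summit.QuantumFields.YangMills.Theses.DualityDefect.PeakSetsTheGap := PeakSetsTheGap_of

end Summit.QuantumFields.YangMills.Cruxes.PeakSetsTheGap.Birth

end
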